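import Literature.NumberTheory.GelbartRogawski1991.UnitaryDualPairThetaKernelTwist
import Literature.NumberTheory.GelbartRogawski1991.UnitaryDualPairWeilCoinvariantsReference
import Literature.NumberTheory.Weil1964.ThetaLiftTransportAdelic
import HarnessLib

/-!
# Non-vanishing of the theta lift of a unitary dual pair does not see the compatible splitting
# (Gelbart–Rogawski 1991 §3.1 Remark: two compatible splittings differ by an automorphic character)

Topic `NumberTheory/GelbartRogawski1991`; namespace `Literature.NumberTheory.GelbartRogawski1991.UnitaryDualPair`.  KERNEL ONLY:
theorems over the tree's CONSTRUCTED theta-kernel datum `UnitaryDualPair.thetaKernelDatum … s hs hρ SK hSK`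
(`UnitaryDualPairThetaKernel`); no `def`, no named fact, nothing of print asserted.

[GelbartRogawski1991, §3.1 Remark p. 457 L4–13]: «the splitting `s` is unique up to `s ↦ s ⊗ ν′` where `ν′` is an automorphic
character».  In the tree: two compatible splittings `s`, `s′` of the dual pair `U(J_V) × U(J_W)` ([GelbartRogawski1991, Prop. 3.1.1])
satisfy `s′ = s ⊗ ĉ` for a character `ĉ : G₁(𝔸_F) →* ℂˣ` trivial on `G₁(F)` (★ `exists_eq_twist_of_isCompatible`), hence
(★ `pairRep_twist_apply'`, `UnitaryDualPairThetaKernelTwist`; §1 restates it as) `(ω_ψ ∘ s′_pair)(p) Φ = ĉ(pairMap p) • (ω_ψ ∘ s_pair)(p) Φ` — the shape (T) of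
★ `Weil1964/ThetaLiftTransportAdelic` with BOTH carrier isomorphisms the identity.  Consequently (§2):

* **`thetaLift_mul_ne_zero_iff_of_twist_splitting`** — for every finite measure `μ` on `[U(J_W)]`, every `Φ ∈ 𝒮(𝔸_Fⁿ)`, every
  `f ∈ C([U(J_W)])` and the continuous multiplier `κ` on `[U(J_W)]` descending `h ↦ ĉ(1 ⊗ h)` (it exists when `s`, `s′` — hence `ĉ` —
  are continuous: `exists_kappa_of_twist_splitting`; it is automorphic):
  `Θ^{s ⊗ ĉ}_Φ(f · κ) ≠ 0 ↔ Θ^{s}_Φ(f) ≠ 0`;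
* in particular (`exists_thetaLift_ne_zero_iff_of_isCompatible`) for ANY two compatible continuous splittings `s`, `s′` there is a
  nowhere-vanishing continuous `κ` with `Θ^{s′}_Φ(f · κ) ≠ 0 ↔ Θ^{s}_Φ(f) ≠ 0` for all `μ`, `Φ`, `f` — a non-vanishing theorem for the
  theta lift proved at ONE compatible splitting (e.g. a constructed one with explicit local components) transfers to every other
  (e.g. the abstract `splittingOf hGR = hGR.choose` the CM model files are built on);
* §3 (ed. 2) the same two statements for a second splitting GIVEN by the equation `s₀ = s ⊗ ĉ` (`subst`):
  `thetaLift_mul_ne_zero_iff_of_eq_twist_splitting`, `exists_kappa_of_eq_twist_splitting`.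

USE (Hodge-CM cell, P4 S4′(ii)): Rallis' inner product formula (★ `Li1992.RallisInnerProductFormulaUnitaryDualPair`) and the local
non-vanishing of the `χ̄`-Fourier coefficient are run at the pin's explicit splitting `s_μ`; the line's model (`cmThetaKernelDatum …
(splittingOf hGR₀)`, ★ `H413RallisTransport`) sits on the abstract one.  Nothing here is specific to that use.

## Mathlib / tree search
Tree: `UnitaryDualPairThetaKernelTwist` (`pairMap`, `pairRep_twist_apply'`, `isCompatible_twist`), `UnitaryDualPairWeilCoinvariantsReference` (`exists_eq_twist_of_isCompatible`), `Weil1964/AdelicMetaplecticScalarTwist`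
(`adelicMpCont.omega_twist`), `UnitaryDualPairSplittingDatum` (`pairSplitting_apply`), `Weil1964/ThetaLiftTransportAdelic`
(`thetaLift_comp_mul_ne_zero_iff_of_twist`, `exists_twist_descend_right'`), `MeasureTheory/Group/InvariantQuotientTransport` (`cosetCongr`).

## References
* [GelbartRogawski1991] S. Gelbart, J. Rogawski, Invent. Math. 105 (1991), §3.1 Prop. 3.1.1 p. 455, Remark p. 457 L4–13.
* [Weil1964] A. Weil, Acta Math. 111 (1964), Chap. III n° 41 Thm 6 p. 193.
* [Li1992] J.-S. Li, J. reine angew. Math. 428 (1992), Thm 2.1 p. 184 (the consumer).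
-/

set_option autoImplicit false

noncomputable section

open _root_.MeasureTheory
open scoped Matrix Kronecker
open NumberField
open Literature.NumberTheory.Automorphic Literature.NumberTheory.Weil1964
open Literature.NumberTheory.Weil1964.ThetaKernelDatum
open Literature.MeasureTheory.Group

namespace Literature.NumberTheory.GelbartRogawski1991

namespace UnitaryDualPair

variable (F E : Type) [Field F] [NumberField F] [Field E] [NumberField E] [Algebra F E]
variable (c : E ≃ₐ[F] E) (N M : ℕ) {n : ℕ} (e : Fin N × Fin M ≃ Fin n)
variable (JV : Matrix (Fin N) (Fin N) E) (JW : Matrix (Fin M) (Fin M) E)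
variable {TV : Matrix (Fin N) (Fin N) F} {TW : Matrix (Fin M) (Fin M) F}
variable [Algebra.IsQuadraticExtension F E] {δ : E} (hcδ : c δ = -δ) (hδ : δ ≠ 0) {d : F}
  (hd : δ * δ = algebraMap F E d) (hV : TV.IsSymm) (hW : TW.IsSymm) (hVd : IsUnit TV.det) (hWd : IsUnit TW.det)
  (hJV : JV = TV.map (algebraMap F E)) (hJW : JW = TW.map (algebraMap F E))

/-! ## §1 The pair representations of `s` and `s ⊗ ĉ` differ by the scalar `ĉ(x ⊗ 1 · 1 ⊗ h)` -/

omit [Algebra.IsQuadraticExtension F E] in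
/-- ★ `pairRep_twist_apply'` in the shape (T) of `Weil1964/ThetaLiftTransportAdelic` (both carrier isomorphisms the identity):
`(ω_ψ ∘ (s ⊗ ĉ)_pair)(p) Φ = ĉ(pairMap p) • (ω_ψ ∘ s_pair)(refl p.1, refl p.2) Φ`. [cite: GelbartRogawski1991, §3.1 Remark p. 457 L4–13] -/
theorem pairRep_twist_apply_refl (s : UnitaryGroup.adelicPair F E c N M JV JW →* adelicMpCont F (Fin n) (adelicGram F e TV TW))
    (ĉ : UnitaryGroup.adelicPair F E c N M JV JW →* ℂˣ) (p : UnitaryGroup.adelic F E c N JV × UnitaryGroup.adelic F E c M JW)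
    (Φ : piSchwartzBruhat F (Fin n)) :
    pairRep F E c N M e JV JW (adelicMpCont.twist F (Fin n) (adelicGram F e TV TW) s ĉ) p Φ =
      (((ĉ.comp (pairMap F E c N M JV JW)) p : ℂˣ) : ℂ) •
        pairRep F E c N M e JV JW s ((MulEquiv.refl _) p.1, (MulEquiv.refl _) p.2) Φ :=
  pairRep_twist_apply' F E c N M e JV JW s ĉ p Φ

/-! ## §2 The theta lifts of `s` and `s ⊗ ĉ`: non-vanishing corresponds -/

section Lift

variable {s : UnitaryGroup.adelicPair F E c N M JV JW →* adelicMpCont F (Fin n) (adelicGram F e TV TW)}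
  (hs : (splittingDatum F E c N M e JV JW hcδ hδ hd hV hW hVd hWd hJV hJW).IsCompatible s)
  (ĉ : UnitaryGroup.adelicPair F E c N M JV JW →* ℂˣ)
  (hs' : (splittingDatum F E c N M e JV JW hcδ hδ hd hV hW hVd hWd hJV hJW).IsCompatible
    (adelicMpCont.twist F (Fin n) (adelicGram F e TV TW) s ĉ))

include hs hs' in
/-- **The multiplier exists**: when `ĉ ∘ (1 ⊗ ·)` is continuous (e.g. `s` and `s ⊗ ĉ` continuous, ★ `exists_eq_twist_of_isCompatible`),
a continuous `κ` on `[U(J_W)]` with `κ([h]) = ĉ(1 ⊗ h)`; the character is trivial on `U(J_W)(F)` by the two stabiliser conditions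
(★ `twist_eq_one_of_mem`). [cite: GelbartRogawski1991, §3.1 Remark p. 457 L4–13] -/
theorem exists_kappa_of_twist_splitting (hc : Continuous fun h : UnitaryGroup.adelic F E c M JW =>
      ((ĉ (UnitaryGroup.adelicInr F E c N M JV JW h) : ℂˣ) : ℂ)) :
    ∃ κ : C(UnitaryGroup.adelic F E c M JW ⧸ (UnitaryGroup.toAdelic F E c M JW).range, ℂ),
      ∀ h : UnitaryGroup.adelic F E c M JW, κ (QuotientGroup.mk h) = ((ĉ (UnitaryGroup.adelicInr F E c N M JV JW h) : ℂˣ) : ℂ) := by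
  have h1 : ∀ h : UnitaryGroup.adelic F E c M JW,
      (((ĉ.comp (pairMap F E c N M JV JW)) (1, h) : ℂˣ) : ℂ) =
        ((ĉ (UnitaryGroup.adelicInr F E c N M JV JW h) : ℂˣ) : ℂ) := fun h => by
    rw [MonoidHom.comp_apply, pairMap_apply, map_one, one_mul]
  have hc' : Continuous fun h : UnitaryGroup.adelic F E c M JW =>
      (((ĉ.comp (pairMap F E c N M JV JW)) (1, h) : ℂˣ) : ℂ) := by
    simp_rw [h1]; exact hc
  obtain ⟨κ, hκ⟩ := exists_twist_descend_right'
    (ΓU := (UnitaryGroup.toAdelic F E c N JV).range) (Γ := (UnitaryGroup.toAdelic F E c M JW).range)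
    (ΓU' := (UnitaryGroup.toAdelic F E c N JV).range) (Γ' := (UnitaryGroup.toAdelic F E c M JW).range)
    (pairRep F E c N M e JV JW s)
    (fun _ hγU _ hγ => pairRep_toHomUnits_mem_thetaStabilizer F E c N M e JV JW hcδ hδ hd hV hW hVd hWd hJV hJW hs hγU hγ)
    (pairRep F E c N M e JV JW (adelicMpCont.twist F (Fin n) (adelicGram F e TV TW) s ĉ))
    (fun _ hγU _ hγ => pairRep_toHomUnits_mem_thetaStabilizer F E c N M e JV JW hcδ hδ hd hV hW hVd hWd hJV hJW hs' hγU hγ)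
    (MulEquiv.refl _) (fun _ => Iff.rfl) (MulEquiv.refl _) (fun _ => Iff.rfl)
    (ĉ.comp (pairMap F E c N M JV JW))
    (fun p Φ => pairRep_twist_apply_refl F E c N M e JV JW s ĉ p Φ) hc'
  exact ⟨κ, fun h => (hκ h).trans (h1 h)⟩

variable [LocallyCompactSpace (UnitaryGroup.adelic F E c N JV)] [LocallyCompactSpace (UnitaryGroup.adelic F E c M JW)]
  (hρ : HasThetaMajorants fun (p : UnitaryGroup.adelic F E c N JV × UnitaryGroup.adelic F E c M JW)
    (Φ : piSchwartzBruhat F (Fin n)) => pairRep F E c N M e JV JW s p Φ)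
  (SK : Set (piSchwartzBruhat F (Fin n)))
  (hSK : ∀ (h : UnitaryGroup.adelic F E c M JW) (Φ : piSchwartzBruhat F (Fin n)), Φ ∈ SK →
    pairRep F E c N M e JV JW s (1, h) Φ ∈ SK)
  (hρ' : HasThetaMajorants fun (p : UnitaryGroup.adelic F E c N JV × UnitaryGroup.adelic F E c M JW)
    (Φ : piSchwartzBruhat F (Fin n)) => pairRep F E c N M e JV JW (adelicMpCont.twist F (Fin n) (adelicGram F e TV TW) s ĉ) p Φ)
  (SK' : Set (piSchwartzBruhat F (Fin n)))
  (hSK' : ∀ (h : UnitaryGroup.adelic F E c M JW) (Φ : piSchwartzBruhat F (Fin n)), Φ ∈ SK' →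
    pairRep F E c N M e JV JW (adelicMpCont.twist F (Fin n) (adelicGram F e TV TW) s ĉ) (1, h) Φ ∈ SK')
  [CompactSpace (UnitaryGroup.adelic F E c N JV ⧸ (UnitaryGroup.toAdelic F E c N JV).range)]
  [CompactSpace (UnitaryGroup.adelic F E c M JW ⧸ (UnitaryGroup.toAdelic F E c M JW).range)]
  [MeasurableSpace (UnitaryGroup.adelic F E c M JW ⧸ (UnitaryGroup.toAdelic F E c M JW).range)]
  [BorelSpace (UnitaryGroup.adelic F E c M JW ⧸ (UnitaryGroup.toAdelic F E c M JW).range)]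
  (μ : Measure (UnitaryGroup.adelic F E c M JW ⧸ (UnitaryGroup.toAdelic F E c M JW).range)) [IsFiniteMeasure μ]

include hs hs' in
/-- **NON-VANISHING OF THE THETA LIFT DOES NOT SEE THE SPLITTING.**  For the lifts of the dual pair at the compatible splittings `s` and
`s ⊗ ĉ`, and the continuous multiplier `κ` on `[U(J_W)]` descending `h ↦ ĉ(1 ⊗ h)`:
`Θ^{s ⊗ ĉ}_Φ(f · κ) ≠ 0 ↔ Θ^{s}_Φ(f) ≠ 0` for every finite `μ`, every `Φ`, every `f`.
[cite: GelbartRogawski1991, §3.1 Remark p. 457 L4–13; Weil1964, Chap. III n° 41 Thm 6 p. 193] -/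
theorem thetaLift_mul_ne_zero_iff_of_twist_splitting
    (κ : C(UnitaryGroup.adelic F E c M JW ⧸ (UnitaryGroup.toAdelic F E c M JW).range, ℂ))
    (hκ : ∀ h : UnitaryGroup.adelic F E c M JW,
      κ (QuotientGroup.mk h) = ((ĉ (UnitaryGroup.adelicInr F E c N M JV JW h) : ℂˣ) : ℂ))
    (Φ : piSchwartzBruhat F (Fin n)) (f : C(UnitaryGroup.adelic F E c M JW ⧸ (UnitaryGroup.toAdelic F E c M JW).range, ℂ)) :
    (thetaKernelDatum F E c N M e JV JW hcδ hδ hd hV hW hVd hWd hJV hJW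
          (adelicMpCont.twist F (Fin n) (adelicGram F e TV TW) s ĉ) hs' hρ' SK' hSK').thetaLift μ Φ (f * κ) ≠ 0 ↔
      (thetaKernelDatum F E c N M e JV JW hcδ hδ hd hV hW hVd hWd hJV hJW s hs hρ SK hSK).thetaLift μ Φ f ≠ 0 := by
  have hκ' : ∀ h : UnitaryGroup.adelic F E c M JW, κ (QuotientGroup.mk h) =
      (((ĉ.comp (pairMap F E c N M JV JW)) (1, h) : ℂˣ) : ℂ) := fun h => by
    rw [hκ, MonoidHom.comp_apply, pairMap_apply, map_one, one_mul]
  have hid : cosetCongr (MulEquiv.refl (UnitaryGroup.adelic F E c M JW)) (UnitaryGroup.toAdelic F E c M JW).range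
      (UnitaryGroup.toAdelic F E c M JW).range (fun _ => Iff.rfl) = id := by
    funext q
    induction q using QuotientGroup.induction_on with
    | H g => rfl
  have key := thetaLift_comp_mul_ne_zero_iff_of_twist
    (ΓU := (UnitaryGroup.toAdelic F E c N JV).range) (Γ := (UnitaryGroup.toAdelic F E c M JW).range)
    (ΓU' := (UnitaryGroup.toAdelic F E c N JV).range) (Γ' := (UnitaryGroup.toAdelic F E c M JW).range)
    (pairRep F E c N M e JV JW s) hρ
    (fun _ hγU _ hγ => pairRep_toHomUnits_mem_thetaStabilizer F E c N M e JV JW hcδ hδ hd hV hW hVd hWd hJV hJW hs hγU hγ)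
    SK hSK (pairRep F E c N M e JV JW (adelicMpCont.twist F (Fin n) (adelicGram F e TV TW) s ĉ)) hρ'
    (fun _ hγU _ hγ => pairRep_toHomUnits_mem_thetaStabilizer F E c N M e JV JW hcδ hδ hd hV hW hVd hWd hJV hJW hs' hγU hγ)
    SK' hSK' (MulEquiv.refl _) (fun _ => Iff.rfl) (MulEquiv.refl _) (fun _ => Iff.rfl)
    (ĉ.comp (pairMap F E c N M JV JW))
    (fun p Φ => pairRep_twist_apply_refl F E c N M e JV JW s ĉ p Φ) μ continuous_id continuous_id κ hκ' Φ f
  have hf : f.comp ⟨cosetCongr (MulEquiv.refl (UnitaryGroup.adelic F E c M JW)) (UnitaryGroup.toAdelic F E c M JW).range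
      (UnitaryGroup.toAdelic F E c M JW).range (fun _ => Iff.rfl), continuous_cosetCongr _ _ _ _ continuous_id⟩ = f := by
    ext q
    induction q using QuotientGroup.induction_on with
    | H g => rfl
  rw [hf, hid, Measure.map_id] at key
  exact key

end Lift

/-! ## §3 (ed. 2) The same for a second splitting GIVEN as `s₀ = s ⊗ ĉ` (the form ★ `exists_eq_twist_of_isCompatible` delivers) -/

section EqTwist

variable [LocallyCompactSpace (UnitaryGroup.adelic F E c N JV)] [LocallyCompactSpace (UnitaryGroup.adelic F E c M JW)]
variable {s s₀ : UnitaryGroup.adelicPair F E c N M JV JW →* adelicMpCont F (Fin n) (adelicGram F e TV TW)}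
  (hs : (splittingDatum F E c N M e JV JW hcδ hδ hd hV hW hVd hWd hJV hJW).IsCompatible s)
  (hs₀ : (splittingDatum F E c N M e JV JW hcδ hδ hd hV hW hVd hWd hJV hJW).IsCompatible s₀)
  (ĉ : UnitaryGroup.adelicPair F E c N M JV JW →* ℂˣ)
  (hρ : HasThetaMajorants fun (p : UnitaryGroup.adelic F E c N JV × UnitaryGroup.adelic F E c M JW)
    (Φ : piSchwartzBruhat F (Fin n)) => pairRep F E c N M e JV JW s p Φ)
  (SK : Set (piSchwartzBruhat F (Fin n)))
  (hSK : ∀ (h : UnitaryGroup.adelic F E c M JW) (Φ : piSchwartzBruhat F (Fin n)), Φ ∈ SK →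
    pairRep F E c N M e JV JW s (1, h) Φ ∈ SK)
  (hρ₀ : HasThetaMajorants fun (p : UnitaryGroup.adelic F E c N JV × UnitaryGroup.adelic F E c M JW)
    (Φ : piSchwartzBruhat F (Fin n)) => pairRep F E c N M e JV JW s₀ p Φ)
  (SK₀ : Set (piSchwartzBruhat F (Fin n)))
  (hSK₀ : ∀ (h : UnitaryGroup.adelic F E c M JW) (Φ : piSchwartzBruhat F (Fin n)), Φ ∈ SK₀ →
    pairRep F E c N M e JV JW s₀ (1, h) Φ ∈ SK₀)
  [CompactSpace (UnitaryGroup.adelic F E c N JV ⧸ (UnitaryGroup.toAdelic F E c N JV).range)]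
  [CompactSpace (UnitaryGroup.adelic F E c M JW ⧸ (UnitaryGroup.toAdelic F E c M JW).range)]
  [MeasurableSpace (UnitaryGroup.adelic F E c M JW ⧸ (UnitaryGroup.toAdelic F E c M JW).range)]
  [BorelSpace (UnitaryGroup.adelic F E c M JW ⧸ (UnitaryGroup.toAdelic F E c M JW).range)]
  (μ : Measure (UnitaryGroup.adelic F E c M JW ⧸ (UnitaryGroup.toAdelic F E c M JW).range)) [IsFiniteMeasure μ]

include hs hs₀ in
/-- **`Θ^{s₀}_Φ(f · κ) ≠ 0 ↔ Θ^{s}_Φ(f) ≠ 0` for any compatible `s₀` GIVEN as `s₀ = s ⊗ ĉ`** (the equation ★ `exists_eq_twist_of_isCompatible`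
produces for two compatible splittings; `subst` + §2), `κ` the continuous multiplier descending `h ↦ ĉ(1 ⊗ h)`.  This is the form a consumer
holding the theta-kernel datum of an ABSTRACT compatible splitting (e.g. `splittingOf hGR = hGR.choose`) applies to a non-vanishing theorem
proved at an EXPLICIT one. [cite: GelbartRogawski1991, §3.1 Remark p. 457 L4–13; Weil1964, Chap. III n° 41 Thm 6 p. 193] -/
theorem thetaLift_mul_ne_zero_iff_of_eq_twist_splitting (heq : s₀ = adelicMpCont.twist F (Fin n) (adelicGram F e TV TW) s ĉ)
    (κ : C(UnitaryGroup.adelic F E c M JW ⧸ (UnitaryGroup.toAdelic F E c M JW).range, ℂ))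
    (hκ : ∀ h : UnitaryGroup.adelic F E c M JW,
      κ (QuotientGroup.mk h) = ((ĉ (UnitaryGroup.adelicInr F E c N M JV JW h) : ℂˣ) : ℂ))
    (Φ : piSchwartzBruhat F (Fin n)) (f : C(UnitaryGroup.adelic F E c M JW ⧸ (UnitaryGroup.toAdelic F E c M JW).range, ℂ)) :
    (thetaKernelDatum F E c N M e JV JW hcδ hδ hd hV hW hVd hWd hJV hJW s₀ hs₀ hρ₀ SK₀ hSK₀).thetaLift μ Φ (f * κ) ≠ 0 ↔
      (thetaKernelDatum F E c N M e JV JW hcδ hδ hd hV hW hVd hWd hJV hJW s hs hρ SK hSK).thetaLift μ Φ f ≠ 0 := by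
  subst heq
  exact thetaLift_mul_ne_zero_iff_of_twist_splitting F E c N M e JV JW hcδ hδ hd hV hW hVd hWd hJV hJW hs ĉ hs₀ hρ SK hSK hρ₀ SK₀ hSK₀
    μ κ hκ Φ f

omit [LocallyCompactSpace (UnitaryGroup.adelic F E c N JV)] [LocallyCompactSpace (UnitaryGroup.adelic F E c M JW)]
  [CompactSpace (UnitaryGroup.adelic F E c N JV ⧸ (UnitaryGroup.toAdelic F E c N JV).range)]
  [CompactSpace (UnitaryGroup.adelic F E c M JW ⧸ (UnitaryGroup.toAdelic F E c M JW).range)]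
  [MeasurableSpace (UnitaryGroup.adelic F E c M JW ⧸ (UnitaryGroup.toAdelic F E c M JW).range)]
  [BorelSpace (UnitaryGroup.adelic F E c M JW ⧸ (UnitaryGroup.toAdelic F E c M JW).range)] in
include hs hs₀ in
/-- the multiplier for `s₀ = s ⊗ ĉ` exists when `h ↦ ĉ(1 ⊗ h)` is continuous. [cite: GelbartRogawski1991, §3.1 Remark p. 457 L4–13] -/
theorem exists_kappa_of_eq_twist_splitting (heq : s₀ = adelicMpCont.twist F (Fin n) (adelicGram F e TV TW) s ĉ)
    (hc : Continuous fun h : UnitaryGroup.adelic F E c M JW => ((ĉ (UnitaryGroup.adelicInr F E c N M JV JW h) : ℂˣ) : ℂ)) :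
    ∃ κ : C(UnitaryGroup.adelic F E c M JW ⧸ (UnitaryGroup.toAdelic F E c M JW).range, ℂ),
      ∀ h : UnitaryGroup.adelic F E c M JW, κ (QuotientGroup.mk h) = ((ĉ (UnitaryGroup.adelicInr F E c N M JV JW h) : ℂˣ) : ℂ) := by
  subst heq
  exact exists_kappa_of_twist_splitting F E c N M e JV JW hcδ hδ hd hV hW hVd hWd hJV hJW hs ĉ hs₀ hc

end EqTwist

end UnitaryDualPair

end Literature.NumberTheory.GelbartRogawski1991
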